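import Mathlib
import Literature.Barriers.MatrixMultiplication.QuasirandomBarrier
import Summits.MatrixMultiplication.MatrixMultiplication.Theses.GLnSeparatingDesigns
import Summits.MatrixMultiplication.MatrixMultiplication.Theorems.GLnSeparatingDesignsBorderHalfDimensionDesignsStubTppOfExactSeparatorsMap
import Summits.MatrixMultiplication.MatrixMultiplication.Theorems.GLnSeparatingDesignsBorderHalfDimensionDesignsStubFiniteFieldShadow

/-!
# E1 assembled: the mod-`p` shadow law for exactly readable designs (line `Ideate5Sketch`)

Stub `stub_pIntegral_volume_le` of line `Ideate5Sketch` (crux `BorderHalfDimensionDesigns`, item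
stmt-MatrixMultiplication-18360, route `GLnSeparatingDesigns`; card `continuous-quasirandom-law`, derivation E1,
barrier note B14).  It composes the two landed stubs

* `tpp_of_exact_separators_map_prod` — exact separators read through a ring map `φ : R →+* F` make (inverted)
  images a TPP triple in `GL_n(F)` with the same volume `|X||Y||Z|`;
* `stub_finiteFieldShadow` — BCGPU 2023 Thm 3.2 (tree-proved) with the cited minimal degree
  `n(GL_n(𝔽_p)) ≥ p^(n−1)` bounds every TPP volume in `GL_n(𝔽_p)`, `p ≥ 5`, `n ≥ 3`, by `2 p^(3n²/2 − (n−1)/2)`;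

into the rigorous face of the conjectured law C⁻ (`stub_separationDegreeLaw`): **for every commutative ring `R`
with a map `φ : R → 𝔽_p` (`p ≥ 5` prime) and every finite `X, Y, Z ⊆ GL_n(R)`, `n ≥ 3`, whose targets are read
EXACTLY through `φ` by polynomials over `R` (value `1` at the target quadruple, `0` at every other one — the
degree is irrelevant), `|X|·|Y|·|Z| ≤ 2 · p^(3n²/2 − (n−1)/2)`.**  In particular an exact design over
`ℤ[1/m]` (integer digit grids + Lagrange interpolation have `m = ` a product of primes `≤ q`) reduces at the
first prime `p ∈ (q, 2q]` (Bertrand) and has volume `O_n(q^(3n²/2 − (n−1)/2))`, short of the crux's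
`q^(3n²/2 − 3εn)` once `ε < (n−1)/(6n)`: the exponent of C⁻ is a THEOREM for this arithmetic sub-class
(conditional only on the cited minimal-degree fact, taken as the hypothesis `hmin`).
-/

set_option linter.dupNamespace false

open scoped Matrix

namespace Summit.MatrixMultiplication.MatrixMultiplication.Theorems.BorderHalfDimensionDesigns

/-- **Mod-`p` shadow law (E1).**  Given the minimal degree `n(GL_n(𝔽_p)) ≥ p^(n−1)` (`p ≥ 5`, `n ≥ 3`;
Tiep–Zalesskii 1996, hypothesis `hmin`), every finite `X, Y, Z ⊆ GL_n(R)` over a commutative ring `R`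
whose targets are read exactly through a ring map `φ : R →+* ZMod p` by polynomials over `R` has
`|X|·|Y|·|Z| ≤ 2 · p^(3n²/2 − (n−1)/2)` — whatever the degrees of the reading polynomials. -/
theorem stub_pIntegral_volume_le
    (hmin : ∀ (p n : ℕ) [Fact p.Prime], 5 ≤ p → 3 ≤ n →
      (p : ℝ) ^ ((n : ℝ) - 1) ≤
        (Literature.Barriers.MatrixMultiplication.secondCharDegree
          (Matrix.GeneralLinearGroup (Fin n) (ZMod p)) : ℝ))
    {R : Type} [CommRing R] {p n : ℕ} [Fact p.Prime] (hp : 5 ≤ p) (hn : 3 ≤ n) (φ : R →+* ZMod p)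
    (X Y Z : Finset (Matrix.GeneralLinearGroup (Fin n) R))
    (hsep : ∀ x₀ ∈ X, ∀ z₀ ∈ Z, ∃ P : MvPolynomial (Fin n × Fin n) R,
      ∀ x ∈ X, ∀ y ∈ Y, ∀ y' ∈ Y, ∀ z ∈ Z,
        ((x = x₀ ∧ y = y' ∧ z = z₀) → φ (MvPolynomial.eval (fun ij : Fin n × Fin n =>
          ((x * y⁻¹ * y' * z⁻¹ : Matrix.GeneralLinearGroup (Fin n) R) : Matrix (Fin n) (Fin n) R) ij.1 ij.2) P) = 1) ∧
        (¬ (x = x₀ ∧ y = y' ∧ z = z₀) → φ (MvPolynomial.eval (fun ij : Fin n × Fin n =>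
          ((x * y⁻¹ * y' * z⁻¹ : Matrix.GeneralLinearGroup (Fin n) R) : Matrix (Fin n) (Fin n) R) ij.1 ij.2) P) = 0)) :
    ((X.card * Y.card * Z.card : ℕ) : ℝ) ≤
      2 * (p : ℝ) ^ ((3 : ℝ) * (n : ℝ) ^ 2 / 2 - ((n : ℝ) - 1) / 2) := by
  obtain ⟨S, T, U, hcard, htpp⟩ := tpp_of_exact_separators_map_prod φ X Y Z hsep
  rw [← hcard]
  exact stub_finiteFieldShadow hmin p n hp hn S T U htpp

end Summit.MatrixMultiplication.MatrixMultiplication.Theorems.BorderHalfDimensionDesigns
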